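import Summits.ABC.ABC.Theorems.IUTThetaPilotThetaPartIIDisplay
import Summits.ABC.ABC.Theorems.IUTThetaPilotJInvWlog
import Summits.ABC.IUTFork.LDHGenuinePoint
import Summits.ABC.ABC.Theorems.IUTThetaPilotThetaPartIIStubThetaData
import Literature.IUT.LogVolume.GenuineLogThetaPerImage
import HarnessLib

/-!
# Route `IUTThetaPilot`, crux `ThetaPartII` (stmt-ABC-19678): the crux — and `ABC` — from children (iii) and (ii′) ALONE

Mochizuki, *Inter-universal Teichmüller theory IV*, RIMS manuscript (Apr. 2020; = PRIMS **57** (2021)), Thm. 1.10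
(pp. 22–31), Cor. 2.2 (ii) (pp. 41–48), Cor. 2.3 (pp. 49–55); [IUTchIII] Cor. 3.12 (kurims p. 174).

The registered layer-2 skeleton `Summit.ABC.ABC.Cruxes.ThetaPartII.Display` (v1.2) reduces the crux
`Summit.ABC.ABC.Theses.IUTThetaPilot.ThetaPartII` to three children, each ∀-quantified over the binders of
`Cor22.Thm110Legendre` (`P ∈ U_P`, `l` prime `≥ 5`, `AdmitsCore`, (P2), (P5), (P6)):
(i) `stub_thetaData` (a genuine Θ-volume datum exists), (iii) `stub_cor312` ([IUTchIII] Cor. 3.12 at every datum —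
DISPUTED, the adjudication object), (ii′) `stub_hullVolume` (the computable half with print's constant `B_III(P,l)`).
Child (i) is a THEOREM (`Summit.ABC.ABC.Theorems.ThetaPartII.stub_thetaData`, abc-iut-L5-t7 g5 over the theta-closure
field `F‡(P)`, abc-iut-w5-d209's ideles and abc-iut-S2's profinite model of the `π₁`-interface `ThetaGeometryInhabited`). This file records the resulting CAMPAIGN-S SHAPE of the route:

* `ThetaPartII_of_cor312_of_hullVolume : stub_cor312 → stub_hullVolume → ThetaPartII` — the crux from (iii) and
  (ii′) alone: a datum `T` at `(P, l)` exists (child (i)); (iii) and (ii′) at `T` give the squeeze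
  `((l+1)/24 − 1/(2l))·log(q^{∤{2,l}}(λ)) ≤ B_III(P,l) + ((l+5)/4)·log π` (`PointDict.logQAvoid_le_of_cor312AtDatum`,
  abc-iut-S2 lineage over abc-iut-c312-8's q-dictionary); then abc-iut-S-d2/c312-8's `ThetaPartII_of_squeezeIII`
  (print's Step (viii), abc-iut-S3's `theorem110` numerics, Cor. 2.2 (ii) from `Thm110Legendre` + the proved (P4) ⇒ (P6)).
* `ABC_of_cor312_of_hullVolume_of_genEllTwo : stub_cor312 → stub_hullVolume → GenEllTwo → ABC` — through the route's
  certified deciding theorem `closes` and the proved support `JInvWlog_proof`.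

So `ABC` is KERNEL-REDUCED to exactly: [IUTchIII] Cor. 3.12 at the genuine Θ-data of the `λ`-line (claim form,
disputed), the log-volume estimate (ii′) (computable half; open residue recorded in plan/D9PRIME-OBLIGATIONS.md §1c),
and [GenEll] Thm. 2.1 at `Σ = {2}` (classical, formalisation debt). CONDITIONAL (`proof.conditional`): the crux item
stays OPEN. HONEST FRAMING: nothing here asserts abc, Thm. 1.10 or Cor. 3.12, or takes a side in the dispute.
-/

set_option linter.dupNamespace false

noncomputable section

namespace Summit.ABC.ABC.Theorems

open Literature.NumberTheory.DiophantineGeometry.GenEll Literature.IUT.LogVolume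

/-- **The crux `ThetaPartII` from children (iii) and (ii′) alone** (child (i) discharged by
`Summit.ABC.ABC.Theorems.ThetaPartII.stub_thetaData`): [IUTchIII] Cor. 3.12 at every genuine Θ-volume datum of every admissible
`(P, l)` and the hull-volume estimate with print's `B_III(P,l)` imply [IUTchIV] Cor. 2.2 (ii) in its uniform form.
CONDITIONAL; does not close the item. [cite: Mochizuki2012, IUTchIV Cor. 2.2 (ii) pp.41–48]
[claim: Mochizuki2012, status: disputed] -/
theorem ThetaPartII_of_cor312_of_hullVolume
    (h312 : ∀ P : NFPoint, P ∈ UP → ∀ l : ℕ, l.Prime → 5 ≤ l →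
      Cor22.AdmitsCore P → Cor22.CondP2 P l → Cor22.CondP5 P l → Cor22.CondP6 P l →
        Cor22.Cor312AtDatum P l)
    (hvol : ∀ P : NFPoint, P ∈ UP → ∀ l : ℕ, l.Prime → 5 ≤ l →
      Cor22.AdmitsCore P → Cor22.CondP2 P l → Cor22.CondP5 P l → Cor22.CondP6 P l →
        Cor22.HullVolumeAtDatum P l (((l : ℝ) + 1) / 4 *
          ((1 + 12 * (Cor22.dmod P : ℝ) / l) * (P.logDiff + Cor22.logCondAvoid P {2, l})
            + 2 * Real.log l + 52
            + 20 / 3 * Real.log (((2 ^ 12 * 3 ^ 3 * 5 * Cor22.dmod P : ℕ) : ℝ) * (l : ℝ))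
              * (Nat.primeCounting (2 ^ 12 * 3 ^ 3 * 5 * Cor22.dmod P * l) : ℝ)))) :
    Summit.ABC.ABC.Theses.IUTThetaPilot.ThetaPartII :=
  ThetaPartIIDisplay.ThetaPartII_of_squeezeIII fun P hP l hl h5 hcore hP2 hP5 h6 => by
    obtain ⟨T⟩ := Summit.ABC.ABC.Theorems.ThetaPartII.stub_thetaData P hP l hl h5 hcore hP2 hP5 h6
    exact Summit.ABC.IUTFork.PointDict.logQAvoid_le_of_cor312AtDatum
      (h312 P hP l hl h5 hcore hP2 hP5 h6) (hvol P hP l hl h5 hcore hP2 hP5 h6) T hP.1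

/-- **`ABC` from children (iii), (ii′) and the support `GenEllTwo`**: [IUTchIII] Cor. 3.12 at the Θ-data of the
`λ`-line, the hull-volume estimate (ii′), and [GenEll] Thm. 2.1 at `Σ = {2}` imply the `abc` conjecture — through the
route's deciding theorem `closes` with `ThetaPartII_of_cor312_of_hullVolume` and the proved `JInvWlog_proof`. Nothing is
asserted unconditionally; no side taken. [cite: Mochizuki2012, IUTchIV Cor. 2.2–2.3 pp.41–55]
[claim: Mochizuki2012, status: disputed] -/
theorem ABC_of_cor312_of_hullVolume_of_genEllTwo
    (h312 : ∀ P : NFPoint, P ∈ UP → ∀ l : ℕ, l.Prime → 5 ≤ l →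
      Cor22.AdmitsCore P → Cor22.CondP2 P l → Cor22.CondP5 P l → Cor22.CondP6 P l →
        Cor22.Cor312AtDatum P l)
    (hvol : ∀ P : NFPoint, P ∈ UP → ∀ l : ℕ, l.Prime → 5 ≤ l →
      Cor22.AdmitsCore P → Cor22.CondP2 P l → Cor22.CondP5 P l → Cor22.CondP6 P l →
        Cor22.HullVolumeAtDatum P l (((l : ℝ) + 1) / 4 *
          ((1 + 12 * (Cor22.dmod P : ℝ) / l) * (P.logDiff + Cor22.logCondAvoid P {2, l})
            + 2 * Real.log l + 52
            + 20 / 3 * Real.log (((2 ^ 12 * 3 ^ 3 * 5 * Cor22.dmod P : ℕ) : ℝ) * (l : ℝ))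
              * (Nat.primeCounting (2 ^ 12 * 3 ^ 3 * 5 * Cor22.dmod P * l) : ℝ))))
    (hG : Summit.ABC.ABC.Theses.IUTThetaPilot.GenEllTwo) : _root_.ABC :=
  Summit.ABC.ABC.Theses.IUTThetaPilot.closes (ThetaPartII_of_cor312_of_hullVolume h312 hvol) hG JInvWlog_proof

/-! ## The per-image line «display-P» (abc-iut-S7's reading (P) of `−|log(Θ)|`, plan R-g8-1 (b) / R-g8-4) -/

/-- **The crux `ThetaPartII` from the display-P children (iii-P) and (ii′-P) alone** (child (i) byte-identical in
both registered lines and DISCHARGED): [IUTchIII] Cor. 3.12 read PER IMAGE at every genuine Θ-volume datum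
(`Cor22.Cor312PerImageAtDatum`, abc-iut-S7 — DISPUTED, claim form) and the per-image hull-volume estimate with print's
`B_III(P,l)` (`Cor22.HullVolumePerImageAtDatum`) give the squeeze at a datum (abc-iut-S7's `Cor22.gap_le_at_perImage` +
`PointDict.gap_eq`), hence the crux. CONDITIONAL; does not close the item. [cite: Mochizuki2012, IUTchIV Cor. 2.2 (ii) pp.41–48]
[claim: Mochizuki2012, status: disputed] -/
theorem ThetaPartII_of_cor312PerImage_of_hullVolumePerImage
    (h312 : ∀ P : NFPoint, P ∈ UP → ∀ l : ℕ, l.Prime → 5 ≤ l →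
      Cor22.AdmitsCore P → Cor22.CondP2 P l → Cor22.CondP5 P l → Cor22.CondP6 P l →
        Cor22.Cor312PerImageAtDatum P l)
    (hvol : ∀ P : NFPoint, P ∈ UP → ∀ l : ℕ, l.Prime → 5 ≤ l →
      Cor22.AdmitsCore P → Cor22.CondP2 P l → Cor22.CondP5 P l → Cor22.CondP6 P l →
        Cor22.HullVolumePerImageAtDatum P l (((l : ℝ) + 1) / 4 *
          ((1 + 12 * (Cor22.dmod P : ℝ) / l) * (P.logDiff + Cor22.logCondAvoid P {2, l})
            + 2 * Real.log l + 52
            + 20 / 3 * Real.log (((2 ^ 12 * 3 ^ 3 * 5 * Cor22.dmod P : ℕ) : ℝ) * (l : ℝ))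
              * (Nat.primeCounting (2 ^ 12 * 3 ^ 3 * 5 * Cor22.dmod P * l) : ℝ)))) :
    Summit.ABC.ABC.Theses.IUTThetaPilot.ThetaPartII :=
  ThetaPartIIDisplay.ThetaPartII_of_squeezeIII fun P hP l hl h5 hcore hP2 hP5 h6 => by
    obtain ⟨T⟩ := Summit.ABC.ABC.Theorems.ThetaPartII.stub_thetaData P hP l hl h5 hcore hP2 hP5 h6
    rw [← Summit.ABC.IUTFork.PointDict.gap_eq T hP.1]
    exact Cor22.gap_le_at_perImage (h312 P hP l hl h5 hcore hP2 hP5 h6) (hvol P hP l hl h5 hcore hP2 hP5 h6) T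

/-- **`ABC` from the display-P children (iii-P), (ii′-P) and the support `GenEllTwo`** — through `closes` and
`JInvWlog_proof`. Nothing asserted unconditionally; no side taken. [cite: Mochizuki2012, IUTchIV Cor. 2.2–2.3 pp.41–55]
[claim: Mochizuki2012, status: disputed] -/
theorem ABC_of_cor312PerImage_of_hullVolumePerImage_of_genEllTwo
    (h312 : ∀ P : NFPoint, P ∈ UP → ∀ l : ℕ, l.Prime → 5 ≤ l →
      Cor22.AdmitsCore P → Cor22.CondP2 P l → Cor22.CondP5 P l → Cor22.CondP6 P l →
        Cor22.Cor312PerImageAtDatum P l)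
    (hvol : ∀ P : NFPoint, P ∈ UP → ∀ l : ℕ, l.Prime → 5 ≤ l →
      Cor22.AdmitsCore P → Cor22.CondP2 P l → Cor22.CondP5 P l → Cor22.CondP6 P l →
        Cor22.HullVolumePerImageAtDatum P l (((l : ℝ) + 1) / 4 *
          ((1 + 12 * (Cor22.dmod P : ℝ) / l) * (P.logDiff + Cor22.logCondAvoid P {2, l})
            + 2 * Real.log l + 52
            + 20 / 3 * Real.log (((2 ^ 12 * 3 ^ 3 * 5 * Cor22.dmod P : ℕ) : ℝ) * (l : ℝ))
              * (Nat.primeCounting (2 ^ 12 * 3 ^ 3 * 5 * Cor22.dmod P * l) : ℝ))))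
    (hG : Summit.ABC.ABC.Theses.IUTThetaPilot.GenEllTwo) : _root_.ABC :=
  Summit.ABC.ABC.Theses.IUTThetaPilot.closes (ThetaPartII_of_cor312PerImage_of_hullVolumePerImage h312 hvol) hG
    JInvWlog_proof

end Summit.ABC.ABC.Theorems

end
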